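/-
Copyright (c) 2026 the pub-hodgecm-mathlib formalisation cell (harness21).  Prover seat hodgecm-mathlib-K2E3-p06 (g4), Track B «K2-LIT», engine E3, unit U4 «Keys»; deal (D61)
LINE LEAD of the open leaf (U4f-χ₁-ram-one), design D-I v2, plan step Z2A-3a «A LOWER UNIPOTENT IN `P·I` LIES IN `I`» — generic place-model part; 2026-09-04.
KERNEL module: THEOREMS ONLY (no definition, no named fact, no `sorry`, no instance, no notation).
-/
import Summits.HodgeConjecture.HodgeConjecture.Theorems.K2E3IwahoriFactorisationThree   -- ★ (K2E3-p05 (g2)): `v_apply_zero_zero_eq_one_of_mem_inf` (`|k₀₀| = 1` on `I`); brings ★ `UnitaryBruhatIwahoriThree` (`cover_borelU_inf`, Iwahori test, `w`-conjugation entries) and ★ BigCell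
import HarnessLib

/-!
# K2 ∕ E3 «EllipticInputs», unit U4 «Keys» — (U4f-χ₁-ram-one) step Z2A-3a: A LOWER UNIPOTENT ELEMENT OF `U(σ, Φ₃)(K)` LYING IN `P · I` ALREADY LIES IN THE IWAHORI `I`
# «`n̄ ∈ N̄ = w N w`, `n̄ = p κ` with `p ∈ P = B`, `κ ∈ I` ⟹ `n̄ ∈ I`»; hence off `I` a lower unipotent lies in the OTHER cell `P · w · I`   [BruhatTits1972 (4.4.4); Casselman1995 Prop. 1.3.1]

Cell hodgecm-mathlib (D-0151), FLOOR 0, Track B «K2-LIT», engine E3, crux item H413 = stmt-HodgeConjecture-24833 (route `HCCMUnconditional`, no route verbs); target BY NAME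
the OPEN leaf `…K2E3EllipticInputs.U4Keys.sig_K2E3KeysThmTwoContractingRamifiedCharOne` (U4Keys ED. 7), design D-I v2, plan step Z2A (Branch A), generic part.  Author K2E3-p06 (g4),
line lead (D61).  `--supports stmt-HodgeConjecture-24833 --as helper`; THEOREMS ONLY.  NOT THE PAYER.

THE POINT.  In Branch A of design D-I the `(I, χ̃)`-type vector `f′` of the reducible principal series vanishes on the cell `P · w · I` (★ Z2-gen
`K2E3TypeVectorSupport.toFun_eq_zero_on_doubleCoset`) and is `f′(1)` times a character on `P · I`; the vanishing functional `Λ_w(f′) = ∫_N f′(w n w) dn` therefore only sees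
the lower unipotents `n̄ = w n w` that lie in `P · I`.  THIS FILE: such an `n̄` already lies in `I` (§2) — so `f′(n̄) = χ̃(n̄) f′(1) = f′(1)` there — and a lower unipotent
OFF `I` lies in `P · w · I` (§3, by ★ `cover_borelU_inf`: `U = P·I ⊔ P·w·I`), where `f′` vanishes.  The proof of §2 is first-column bookkeeping: `n̄ = ū` has rows
`(1,0,0)`, `(−σx, 1, 0)`, `(z, x, 1)` (§1, ★ `exists_coe_eq_upper_of_mem_unipotentU` conjugated by `w`), and `p = n̄ κ⁻¹` upper triangular forces
`σx · k₀₀ = k₁₀` and `z k₀₀ + x k₁₀ + k₂₀ = 0` for `k = κ⁻¹ ∈ I` (`|k₀₀| = 1` ★ `v_apply_zero_zero_eq_one_of_mem_inf`, `|k₁₀|, |k₂₀| < 1` ★ Iwahori test), whence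
`|x|, |z| < 1` and `n̄ ∈ I` (★ `mem_glInt_inf_conj_glInt_of_v_lt_one`).  Everything over a valued field `K` with an isometric involution `σ`, ANY residue characteristic —
the place model of ★ Road II∕II′; the CM dress (Z2A-3b∕c) transports it along `eA`.
* §1 `exists_coe_eq_lower_of_mem_map` (shape of `N̄ = N.map (conj w)`), `coe_apply_zero_zero_eq_one_of_mem_map`.
* §2 **`mem_inf_of_eq_borel_mul`** (`n̄ = p κ`, `p ∈ B`, `κ ∈ I` ⟹ `n̄ ∈ I`).
* §3 `ne_borel_mul_of_not_mem`, **`exists_eq_borel_mul_weylLongU_mul_of_not_mem`** (`n̄ ∉ I` ⟹ `n̄ = p · w · κ`), `mem_inf_or_exists_eq_borel_mul_weylLongU_mul` (the dichotomy).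
HONEST LABEL: HC_CM is proved only modulo the 7 printed citations (2 remaining named inputs: hLiu418 = stmt-HodgeConjecture-24832, h413 = stmt-HodgeConjecture-24833)
until rung 0 closes; count-neutral — this file does NOT pay the leaf; no printed citation is discharged.

## References
* [BruhatTits1972] F. Bruhat, J. Tits, *Groupes réductifs sur un corps local I*, Publ. Math. IHÉS 41 (1972), (4.4.3)–(4.4.4) (Iwahori subgroup and the affine Bruhat cells of a rank-one group).
* [Casselman1995] W. Casselman, *Introduction to the theory of admissible representations of `p`-adic reductive groups* (1995), Prop. 1.3.1, Prop. 1.4.4.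
* [Rogawski1990] J. Rogawski, *Automorphic representations of unitary groups in three variables*, Ann. of Math. Stud. 123 (1990), §1.10 p. 9 (the groups `B = TN`, `N̄`, `w`).
-/

set_option autoImplicit false
-- the mandated namespace has the single-problem summit's repeated segment (`HodgeConjecture.HodgeConjecture`)
set_option linter.dupNamespace false

noncomputable section

open Matrix Literature.NumberTheory.Automorphic Literature.NumberTheory.Automorphic.UnitaryGroup
open scoped Matrix MatrixGroups WithZero

namespace Summit.HodgeConjecture.HodgeConjecture.Cruxes.H413.K2E3LowerUnipotentBorelIwahori

variable {K : Type*} [Field K] [Valued K ℤᵐ⁰] [ValuativeRel K] [(Valued.v : Valuation K ℤᵐ⁰).Compatible]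
  (σ : K →+* K) {ϖ : K} {J : Matrix (Fin 3) (Fin 3) K} (hJ : J = (StdForm.antidiagonal 3).over K)
  (hσ : ∀ a, σ (σ a) = a) (hvσ : ∀ a, Valued.v (σ a) = Valued.v a) (hvϖ : Valued.v ϖ = WithZero.exp (-1 : ℤ))
  (g₁ : GL (Fin 3) K) (hg₁ : (g₁ : Matrix (Fin 3) (Fin 3) K) = Matrix.diagonal ![(1 : K), 1, ϖ])

/-! ## §1 The shape of an element of `N̄ = w N w` -/

omit [Valued K ℤᵐ⁰] [ValuativeRel K] [(Valued.v : Valuation K ℤᵐ⁰).Compatible] in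
include hσ in
/-- **The shape of a lower unipotent element**: `n̄ ∈ N̄ = N.map (conj w)` has matrix `ū = !![1, 0, 0; -σ x, 1, 0; z, x, 1]` with `z + σ z + x σ x = 0` — the `w`-conjugate
(rows and columns reversed, ★ `coe_weylLongU_mul_mul_weylLongU_apply'`, `w⁻¹ = w`) of `u(x, z) ∈ N` (★ `exists_coe_eq_upper_of_mem_unipotentU`). [cite: Rogawski1990, §1.10 p. 9] -/
theorem exists_coe_eq_lower_of_mem_map {nb : ↥(unitaryGroupOfForm σ J)}
    (hnb : nb ∈ ((borelTriple σ J hJ).N).map (MulAut.conj (weylLongU σ hJ)).toMonoidHom) :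
    ∃ x z : K, ((nb : GL (Fin 3) K) : Matrix (Fin 3) (Fin 3) K) = !![1, 0, 0; -σ x, 1, 0; z, x, 1] ∧ z + σ z + x * σ x = 0 := by
  obtain ⟨n, hn, rfl⟩ := Subgroup.mem_map.1 hnb
  have hn' : n ∈ unipotentU σ J := hn
  obtain ⟨x, z, hnv, hrel⟩ := exists_coe_eq_upper_of_mem_unipotentU σ hJ hσ hn'
  have hwinv : (weylLongU σ hJ)⁻¹ = weylLongU σ hJ := inv_eq_of_mul_eq_one_right (weylLongU_mul_weylLongU σ hJ)
  have hconj : (MulAut.conj (weylLongU σ hJ)).toMonoidHom n = weylLongU σ hJ * n * weylLongU σ hJ := by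
    rw [MulEquiv.coe_toMonoidHom, MulAut.conj_apply, hwinv]
  refine ⟨x, z, ?_, hrel⟩
  ext i j
  rw [hconj, coe_weylLongU_mul_mul_weylLongU_apply' σ hJ n i j, hnv]
  fin_cases i <;> fin_cases j <;> rfl

omit [Valued K ℤᵐ⁰] [ValuativeRel K] [(Valued.v : Valuation K ℤᵐ⁰).Compatible] in
include hσ in
/-- The `(0,0)` entry of a lower unipotent element is `1` (so the depth-zero character `χ̃(j) = χ₁(j₀₀)` of ★ Z2A-1 is trivial on `N̄ ∩ I`). [cite: Rogawski1990, §1.10 p. 9] -/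
theorem coe_apply_zero_zero_eq_one_of_mem_map {nb : ↥(unitaryGroupOfForm σ J)}
    (hnb : nb ∈ ((borelTriple σ J hJ).N).map (MulAut.conj (weylLongU σ hJ)).toMonoidHom) :
    ((nb : GL (Fin 3) K) : Matrix (Fin 3) (Fin 3) K) 0 0 = 1 := by
  obtain ⟨x, z, hnbv, -⟩ := exists_coe_eq_lower_of_mem_map σ hJ hσ hnb
  rw [hnbv]; rfl

/-! ## §2 A lower unipotent in `P · I` lies in `I` -/

include hJ hσ hvσ hvϖ hg₁ in
/-- **`n̄ ∈ N̄`, `n̄ = p · κ` with `p ∈ B` (upper triangular) and `κ ∈ I = K₀ ⊓ K₁` ⟹ `n̄ ∈ I`.**  With `k = κ⁻¹ ∈ I` and `n̄ = ū(x, z)` (§1), the vanishing of the `(1,0)` and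
`(2,0)` entries of `p = n̄ k` reads `σx · k₀₀ = k₁₀`, `z k₀₀ + x k₁₀ + k₂₀ = 0`; since `|k₀₀| = 1` (★ `v_apply_zero_zero_eq_one_of_mem_inf`) and `|k₁₀|, |k₂₀| < 1` (★ Iwahori test)
this gives `|x| < 1`, `|z| < 1`, i.e. `n̄` is integral with `|n̄₂₀| < 1` (★ `mem_glInt_inf_conj_glInt_of_v_lt_one`). [cite: BruhatTits1972, (4.4.4)] [cite: Casselman1995, Prop. 1.4.4] -/
theorem mem_inf_of_eq_borel_mul {nb p κ : ↥(unitaryGroupOfForm σ J)}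
    (hnb : nb ∈ ((borelTriple σ J hJ).N).map (MulAut.conj (weylLongU σ hJ)).toMonoidHom)
    (hp : p ∈ borelU σ J)
    (hκ : κ ∈ (glInt 3 K).subgroupOf (unitaryGroupOfForm σ J) ⊓ ((glInt 3 K).map (MulAut.conj g₁).toMonoidHom).subgroupOf (unitaryGroupOfForm σ J))
    (h : nb = p * κ) :
    nb ∈ (glInt 3 K).subgroupOf (unitaryGroupOfForm σ J) ⊓ ((glInt 3 K).map (MulAut.conj g₁).toMonoidHom).subgroupOf (unitaryGroupOfForm σ J) := by
  obtain ⟨x, z, hnbv, -⟩ := exists_coe_eq_lower_of_mem_map σ hJ hσ hnb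
  have hk : κ⁻¹ ∈ (glInt 3 K).subgroupOf (unitaryGroupOfForm σ J) ⊓ ((glInt 3 K).map (MulAut.conj g₁).toMonoidHom).subgroupOf (unitaryGroupOfForm σ J) :=
    Subgroup.inv_mem _ hκ
  obtain ⟨-, h20, -, h10⟩ := (mem_glInt_inf_conj_glInt_iff σ hJ hvσ hvϖ g₁ hg₁ κ⁻¹).1 hk
  have h00 := K2E3IwahoriFactorisationThree.v_apply_zero_zero_eq_one_of_mem_inf σ hJ hvσ hvϖ g₁ hg₁ hk
  have hk00 : (((κ⁻¹ : ↥(unitaryGroupOfForm σ J)) : GL (Fin 3) K) : Matrix (Fin 3) (Fin 3) K) 0 0 ≠ 0 := fun h0 => by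
    rw [h0, map_zero] at h00; exact zero_ne_one h00
  have hpk : p = nb * κ⁻¹ := by rw [h, mul_inv_cancel_right]
  -- the `(i,0)` entries of `p = n̄ k`
  have hentry : ∀ i : Fin 3, ((p : GL (Fin 3) K) : Matrix (Fin 3) (Fin 3) K) i 0 =
      ∑ m : Fin 3, (!![1, 0, 0; -σ x, 1, 0; z, x, 1] : Matrix (Fin 3) (Fin 3) K) i m *
        (((κ⁻¹ : ↥(unitaryGroupOfForm σ J)) : GL (Fin 3) K) : Matrix (Fin 3) (Fin 3) K) m 0 := fun i => by
    rw [hpk, Subgroup.coe_mul, Units.val_mul, Matrix.mul_apply, hnbv]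
  have e10 : ((p : GL (Fin 3) K) : Matrix (Fin 3) (Fin 3) K) 1 0 = 0 := (mem_borelU_iff p).1 hp (show id (0 : Fin 3) < id 1 by decide)
  have e20 : ((p : GL (Fin 3) K) : Matrix (Fin 3) (Fin 3) K) 2 0 = 0 := (mem_borelU_iff p).1 hp (show id (0 : Fin 3) < id 2 by decide)
  have r10 : (!![1, 0, 0; -σ x, 1, 0; z, x, 1] : Matrix (Fin 3) (Fin 3) K) 1 0 = -σ x := rfl
  have r11 : (!![1, 0, 0; -σ x, 1, 0; z, x, 1] : Matrix (Fin 3) (Fin 3) K) 1 1 = 1 := rfl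
  have r12 : (!![1, 0, 0; -σ x, 1, 0; z, x, 1] : Matrix (Fin 3) (Fin 3) K) 1 2 = 0 := rfl
  have r20 : (!![1, 0, 0; -σ x, 1, 0; z, x, 1] : Matrix (Fin 3) (Fin 3) K) 2 0 = z := rfl
  have r21 : (!![1, 0, 0; -σ x, 1, 0; z, x, 1] : Matrix (Fin 3) (Fin 3) K) 2 1 = x := rfl
  have r22 : (!![1, 0, 0; -σ x, 1, 0; z, x, 1] : Matrix (Fin 3) (Fin 3) K) 2 2 = 1 := rfl
  rw [hentry, Fin.sum_univ_three, r10, r11, r12] at e10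
  rw [hentry, Fin.sum_univ_three, r20, r21, r22] at e20
  -- `|x| < 1`
  have hσx : σ x = (((κ⁻¹ : ↥(unitaryGroupOfForm σ J)) : GL (Fin 3) K) : Matrix (Fin 3) (Fin 3) K) 1 0 *
      ((((κ⁻¹ : ↥(unitaryGroupOfForm σ J)) : GL (Fin 3) K) : Matrix (Fin 3) (Fin 3) K) 0 0)⁻¹ := by
    rw [eq_mul_inv_iff_mul_eq₀ hk00]; linear_combination -e10
  have hvx : Valued.v x < 1 := by
    rw [← hvσ, hσx, map_mul, map_inv₀, h00, inv_one, mul_one]; exact h10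
  -- `|z| < 1`
  have hz : z = -(x * (((κ⁻¹ : ↥(unitaryGroupOfForm σ J)) : GL (Fin 3) K) : Matrix (Fin 3) (Fin 3) K) 1 0 +
        (((κ⁻¹ : ↥(unitaryGroupOfForm σ J)) : GL (Fin 3) K) : Matrix (Fin 3) (Fin 3) K) 2 0) *
      ((((κ⁻¹ : ↥(unitaryGroupOfForm σ J)) : GL (Fin 3) K) : Matrix (Fin 3) (Fin 3) K) 0 0)⁻¹ := by
    rw [eq_mul_inv_iff_mul_eq₀ hk00]; linear_combination e20
  have hvz : Valued.v z < 1 := by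
    rw [hz, map_mul, map_inv₀, h00, inv_one, mul_one, Valuation.map_neg]
    refine Valued.v.map_add_lt ?_ h20
    rw [map_mul]
    calc Valued.v x * Valued.v ((((κ⁻¹ : ↥(unitaryGroupOfForm σ J)) : GL (Fin 3) K) : Matrix (Fin 3) (Fin 3) K) 1 0)
        ≤ 1 * Valued.v ((((κ⁻¹ : ↥(unitaryGroupOfForm σ J)) : GL (Fin 3) K) : Matrix (Fin 3) (Fin 3) K) 1 0) := by gcongr
      _ < 1 := by rw [one_mul]; exact h10
  -- `n̄` is integral with `|n̄₂₀| < 1`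
  have hK0 : nb ∈ (glInt 3 K).subgroupOf (unitaryGroupOfForm σ J) := by
    rw [mem_glInt_subgroupOf_iff σ hJ hvσ, hnbv]
    intro i j
    fin_cases i <;> fin_cases j <;> simp [hvσ, hvx.le, hvz.le]
  exact mem_glInt_inf_conj_glInt_of_v_lt_one σ hJ hvσ hvϖ g₁ hg₁ hK0 (by rw [hnbv]; simpa using hvz)

/-! ## §3 Off `I`, a lower unipotent lies in the cell `P · w · I` -/

include hJ hσ hvσ hvϖ hg₁ in
/-- `n̄ ∈ N̄ ∖ I` is NOT of the form `p κ` (`p ∈ B`, `κ ∈ I`) — contrapositive of §2. [cite: BruhatTits1972, (4.4.4)] -/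
theorem ne_borel_mul_of_not_mem {nb : ↥(unitaryGroupOfForm σ J)}
    (hnb : nb ∈ ((borelTriple σ J hJ).N).map (MulAut.conj (weylLongU σ hJ)).toMonoidHom)
    (hnI : nb ∉ (glInt 3 K).subgroupOf (unitaryGroupOfForm σ J) ⊓ ((glInt 3 K).map (MulAut.conj g₁).toMonoidHom).subgroupOf (unitaryGroupOfForm σ J))
    {p κ : ↥(unitaryGroupOfForm σ J)} (hp : p ∈ borelU σ J)
    (hκ : κ ∈ (glInt 3 K).subgroupOf (unitaryGroupOfForm σ J) ⊓ ((glInt 3 K).map (MulAut.conj g₁).toMonoidHom).subgroupOf (unitaryGroupOfForm σ J)) :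
    nb ≠ p * κ :=
  fun h => hnI (mem_inf_of_eq_borel_mul σ hJ hσ hvσ hvϖ g₁ hg₁ hnb hp hκ h)

include hJ hσ hvσ hvϖ hg₁ in
/-- **`n̄ ∈ N̄ ∖ I` ⟹ `n̄ = p · w · κ` with `p ∈ B`, `κ ∈ I`** — by ★ `cover_borelU_inf` (`U = B·I ∪ B·w·I`) and §2 (the cell `B·I` is excluded).  In the letters of ★ Z2-gen
`K2E3TypeVectorSupport.toFun_eq_zero_on_doubleCoset` (`f.toFun (h * g₀ * b') = 0` at `g₀ = w`): the type vector VANISHES at such `n̄`. [cite: BruhatTits1972, (4.4.4)] [cite: Casselman1995, Prop. 1.3.1] -/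
theorem exists_eq_borel_mul_weylLongU_mul_of_not_mem {nb : ↥(unitaryGroupOfForm σ J)}
    (hnb : nb ∈ ((borelTriple σ J hJ).N).map (MulAut.conj (weylLongU σ hJ)).toMonoidHom)
    (hnI : nb ∉ (glInt 3 K).subgroupOf (unitaryGroupOfForm σ J) ⊓ ((glInt 3 K).map (MulAut.conj g₁).toMonoidHom).subgroupOf (unitaryGroupOfForm σ J)) :
    ∃ p ∈ borelU σ J, ∃ κ ∈ (glInt 3 K).subgroupOf (unitaryGroupOfForm σ J) ⊓ ((glInt 3 K).map (MulAut.conj g₁).toMonoidHom).subgroupOf (unitaryGroupOfForm σ J),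
      nb = p * weylLongU σ hJ * κ := by
  obtain ⟨i, ⟨p, hp⟩, κ, hκ, e⟩ := cover_borelU_inf σ hJ hσ hvσ hvϖ g₁ hg₁ nb
  fin_cases i
  · exact absurd (by simpa using e) (ne_borel_mul_of_not_mem σ hJ hσ hvσ hvϖ g₁ hg₁ hnb hnI hp hκ)
  · exact ⟨p, hp, κ, hκ, by simpa using e⟩

include hJ hσ hvσ hvϖ hg₁ in
/-- **THE DICHOTOMY for lower unipotents**: `n̄ ∈ N̄` lies in `I`, or `n̄ = p · w · κ` (`p ∈ B`, `κ ∈ I`) — the two cells of `U = B·I ⊔ B·w·I` seen from `N̄`; with ★ Z2-gen this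
makes the `(I, χ̃)`-type vector equal to `f′(1)·𝟙_{N̄ ∩ I}` on `N̄` (Z2A-3c). [cite: BruhatTits1972, (4.4.4)] [cite: Casselman1995, Prop. 1.3.1] -/
theorem mem_inf_or_exists_eq_borel_mul_weylLongU_mul {nb : ↥(unitaryGroupOfForm σ J)}
    (hnb : nb ∈ ((borelTriple σ J hJ).N).map (MulAut.conj (weylLongU σ hJ)).toMonoidHom) :
    nb ∈ (glInt 3 K).subgroupOf (unitaryGroupOfForm σ J) ⊓ ((glInt 3 K).map (MulAut.conj g₁).toMonoidHom).subgroupOf (unitaryGroupOfForm σ J) ∨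
      ∃ p ∈ borelU σ J, ∃ κ ∈ (glInt 3 K).subgroupOf (unitaryGroupOfForm σ J) ⊓ ((glInt 3 K).map (MulAut.conj g₁).toMonoidHom).subgroupOf (unitaryGroupOfForm σ J),
        nb = p * weylLongU σ hJ * κ := by
  by_cases hnI : nb ∈ (glInt 3 K).subgroupOf (unitaryGroupOfForm σ J) ⊓ ((glInt 3 K).map (MulAut.conj g₁).toMonoidHom).subgroupOf (unitaryGroupOfForm σ J)
  · exact Or.inl hnI
  · exact Or.inr (exists_eq_borel_mul_weylLongU_mul_of_not_mem σ hJ hσ hvσ hvϖ g₁ hg₁ hnb hnI)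

end Summit.HodgeConjecture.HodgeConjecture.Cruxes.H413.K2E3LowerUnipotentBorelIwahori

end
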